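import Literature.Probability.FitznerVanDerHofstad2017.BlockSummationReal

/-!
# [FvdH17] §5.3: from entrywise numerical majorants of the block matrices to the REAL bound — PROVED in abstract form

Source: R. Fitzner, R. van der Hofstad, *Mean-field behavior for nearest-neighbor percolation in `d > 10`*,
Electron. J. Probab. **22** (2017) no. 43 [FvdH17]; page and equation numbers are those of the extended version
arXiv:1506.07977v2.  §2.3 (p. 13): "This gives rise to a bound on the NoBLE coefficients in terms of a matrix product,
as given in Section 5.3 below."; §5.1 "Elements of the bounds" (p. 49) (the matrix entries `(B)_{a,b}`, `(Ā^{ι,[F]})_{a,b}`,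
the vectors `P⃗^S`, `P⃗^E`); Prop. 5.5 (5.34), Prop. 5.6 (5.37) (p. 53); §5.4 "Summary of the bounds" (p. 56): "Using that
`p = p_I` …, or that the bootstrap function are bounded, we can compute numerical bounds on these diagrammatic bounds, see
… for the idea of these bounds, or [FitHof13b, Section 5] for a complete description."; notebook [FvdHnb] `Percolation.nb`
(`Matrix[B,s]`, `Matrix[Abar,…]`, `VecPS`, `VecPE` evaluated as real `3 × 3` matrices / vectors of simple-diagram
bounds).

What this module proves — everything is kernel-checked; NOTHING here is a cited hypothesis.  In the published
argument the abstract matrices `B, Ā, B̄, P⃗S, P⃗E` (suprema of sums of block diagrams) are never computed: they are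
MAJORISED entrywise by real numbers built from simple-diagram bounds, and the products are taken with the majorants.
This module is that step, over `[0, ∞]`-valued kernels:
* `vecMul_le_of_le`, `mulVec_le_of_le`, `dotProduct_le_of_le`, `mul_apply_le_of_le`, `pow_apply_le_of_le` — entrywise
  monotonicity of the matrix operations in `[0, ∞]` [folklore];
* `summable_toReal_and_tsum_le_of_majorants` — if `Σ_x Ξ(x) ≤ u ⬝ᵥ ((B^M * A * B̄^m) *ᵥ w)` in `[0, ∞]` and
  `u ≤ uℝ`, `B ≤ Bℝ`, `A ≤ Aℝ`, `B̄ ≤ B̄ℝ`, `w ≤ wℝ` entrywise (real majorants with non-negative entries, compared via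
  `ENNReal.ofReal`), then `x ↦ (Ξ x).toReal` is summable and `Σ_x (Ξ x).toReal ≤ uℝ ⬝ᵥ ((Bℝ^M * Aℝ * B̄ℝ^m) *ᵥ wℝ)` —
  a real inequality in the REAL majorant matrices, the shape of the tree's `EigenTails.tailTerm`;
* `tsum_toReal_le_of_xSpaceBound_of_majorants` — combined with `BlockSummationReal.tsum_le_dotProduct_mulVec`: the
  Lemma 6.1 (6.51)-shaped `x`-space hypothesis plus entrywise real majorants of `vecP PS`, `matB B`, `matAbar Ā`,
  `matBR B̄`, `vecP PE` give the real inequality directly (no `toReal` of a supremum is left to evaluate).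
Abstract setting as in the sibling modules; no block of §5.1 is defined and no number is produced.
-/

noncomputable section

namespace Literature.Probability.FitznerVanDerHofstad2017.BlockSummation

open scoped ENNReal Matrix
open Matrix

section Monotone

variable {ι : Type*} [Fintype ι]

/-- Entrywise monotonicity of `v ᵥ* M` in `[0, ∞]`. [folklore] -/
theorem vecMul_le_of_le {v v' : ι → ℝ≥0∞} {M M' : Matrix ι ι ℝ≥0∞} (hv : ∀ a, v a ≤ v' a)
    (hM : ∀ a b, M a b ≤ M' a b) (b : ι) : (v ᵥ* M) b ≤ (v' ᵥ* M') b := by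
  show ∑ a, v a * M a b ≤ ∑ a, v' a * M' a b
  exact Finset.sum_le_sum fun a _ => mul_le_mul' (hv a) (hM a b)

/-- Entrywise monotonicity of `M *ᵥ w` in `[0, ∞]`. [folklore] -/
theorem mulVec_le_of_le {M M' : Matrix ι ι ℝ≥0∞} {w w' : ι → ℝ≥0∞} (hM : ∀ a b, M a b ≤ M' a b)
    (hw : ∀ b, w b ≤ w' b) (a : ι) : (M *ᵥ w) a ≤ (M' *ᵥ w') a := by
  show ∑ b, M a b * w b ≤ ∑ b, M' a b * w' b
  exact Finset.sum_le_sum fun b _ => mul_le_mul' (hM a b) (hw b)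

/-- Monotonicity of the dot product in `[0, ∞]`. [folklore] -/
theorem dotProduct_le_of_le {v v' w w' : ι → ℝ≥0∞} (hv : ∀ a, v a ≤ v' a) (hw : ∀ a, w a ≤ w' a) :
    v ⬝ᵥ w ≤ v' ⬝ᵥ w' :=
  Finset.sum_le_sum fun a _ => mul_le_mul' (hv a) (hw a)

/-- Entrywise monotonicity of the matrix product in `[0, ∞]`. [folklore] -/
theorem mul_apply_le_of_le {M M' N N' : Matrix ι ι ℝ≥0∞} (hM : ∀ a b, M a b ≤ M' a b)
    (hN : ∀ a b, N a b ≤ N' a b) (a b : ι) : (M * N) a b ≤ (M' * N') a b := by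
  rw [Matrix.mul_apply, Matrix.mul_apply]
  exact Finset.sum_le_sum fun c _ => mul_le_mul' (hM a c) (hN c b)

/-- Entrywise monotonicity of matrix powers in `[0, ∞]`. [folklore] -/
theorem pow_apply_le_of_le [DecidableEq ι] {M M' : Matrix ι ι ℝ≥0∞} (hM : ∀ a b, M a b ≤ M' a b) :
    ∀ (k : ℕ) (a b : ι), (M ^ k) a b ≤ (M' ^ k) a b
  | 0, a, b => by rw [pow_zero, pow_zero]
  | k + 1, a, b => by
      rw [pow_succ, pow_succ]
      exact mul_apply_le_of_le (pow_apply_le_of_le hM k) hM a b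

end Monotone

section Majorants

variable {ι : Type*} [Fintype ι] [DecidableEq ι]

/-- **Majorant form of the bridge.** If `Σ_x Ξ(x) ≤ u ⬝ᵥ ((B^M * A * B̄^m) *ᵥ w)` in `[0, ∞]` and the vectors /
matrices are majorised entrywise by real data with non-negative entries (`u a ≤ ENNReal.ofReal (uℝ a)`, …), then
`x ↦ (Ξ x).toReal` is summable and `Σ_x (Ξ x).toReal ≤ uℝ ⬝ᵥ ((Bℝ^M * Aℝ * B̄ℝ^m) *ᵥ wℝ)`.
[cite: FitznerVanDerHofstad2017, §2.3 (arXiv:1506.07977v2 p. 13), §5.1 "Elements of the bounds" (p. 49), Prop. 5.5 (5.34) (p. 53), §5.4 (p. 56)] -/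
theorem summable_toReal_and_tsum_le_of_majorants {α : Type*} {Ξ : α → ℝ≥0∞} {u w : ι → ℝ≥0∞}
    {B A Bb : Matrix ι ι ℝ≥0∞} {uR wR : ι → ℝ} {BR AR BbR : Matrix ι ι ℝ}
    (hu0 : ∀ a, 0 ≤ uR a) (hw0 : ∀ b, 0 ≤ wR b) (hB0 : ∀ a b, 0 ≤ BR a b) (hA0 : ∀ a b, 0 ≤ AR a b)
    (hBb0 : ∀ a b, 0 ≤ BbR a b)
    (hu : ∀ a, u a ≤ ENNReal.ofReal (uR a)) (hw : ∀ b, w b ≤ ENNReal.ofReal (wR b))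
    (hB : ∀ a b, B a b ≤ ENNReal.ofReal (BR a b)) (hA : ∀ a b, A a b ≤ ENNReal.ofReal (AR a b))
    (hBb : ∀ a b, Bb a b ≤ ENNReal.ofReal (BbR a b)) (M m : ℕ)
    (h : ∑' x, Ξ x ≤ u ⬝ᵥ ((B ^ M * A * Bb ^ m) *ᵥ w)) :
    Summable (fun x => (Ξ x).toReal) ∧
      ∑' x, (Ξ x).toReal ≤ uR ⬝ᵥ ((BR ^ M * AR * BbR ^ m) *ᵥ wR) := by
  have h' : ∑' x, Ξ x ≤ (fun a => ENNReal.ofReal (uR a)) ⬝ᵥ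
      (((BR.map ENNReal.ofReal) ^ M * AR.map ENNReal.ofReal * (BbR.map ENNReal.ofReal) ^ m) *ᵥ
        fun b => ENNReal.ofReal (wR b)) :=
    h.trans (dotProduct_le_of_le hu (mulVec_le_of_le
      (mul_apply_le_of_le (mul_apply_le_of_le (pow_apply_le_of_le hB M) hA) (pow_apply_le_of_le hBb m)) hw))
  obtain ⟨hs, hle⟩ := summable_toReal_and_tsum_le (Ξ := Ξ) (u := fun a => ENNReal.ofReal (uR a))
    (w := fun b => ENNReal.ofReal (wR b)) (B := BR.map ENNReal.ofReal) (A := AR.map ENNReal.ofReal)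
    (Bb := BbR.map ENNReal.ofReal) (fun _ => ENNReal.ofReal_ne_top) (fun _ => ENNReal.ofReal_ne_top)
    (fun _ _ => ENNReal.ofReal_ne_top) (fun _ _ => ENNReal.ofReal_ne_top) (fun _ _ => ENNReal.ofReal_ne_top)
    M m h'
  refine ⟨hs, hle.trans_eq ?_⟩
  have eu : (fun a => (ENNReal.ofReal (uR a)).toReal) = uR := funext fun a => ENNReal.toReal_ofReal (hu0 a)
  have ew : (fun b => (ENNReal.ofReal (wR b)).toReal) = wR := funext fun b => ENNReal.toReal_ofReal (hw0 b)
  have eB : (BR.map ENNReal.ofReal).map ENNReal.toReal = BR :=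
    Matrix.ext fun a b => ENNReal.toReal_ofReal (hB0 a b)
  have eA : (AR.map ENNReal.ofReal).map ENNReal.toReal = AR :=
    Matrix.ext fun a b => ENNReal.toReal_ofReal (hA0 a b)
  have eBb : (BbR.map ENNReal.ofReal).map ENNReal.toReal = BbR :=
    Matrix.ext fun a b => ENNReal.toReal_ofReal (hBb0 a b)
  rw [eu, ew, eB, eA, eBb]

end Majorants

section RealBoundMajorants

variable {G ι K : Type*}

/-- **Lemma 6.1 summed, as a real inequality in the numerical majorants.** From the (6.51)-shaped `x`-space
hypothesis (left piece `P^{(M)} = recP PS B M`, junction `Ā`, right piece `R^{(m)} = recR PE B̄ m`, all blocks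
translation invariant) and entrywise real majorants with non-negative entries `vecP PS ≤ uℝ`, `matB B ≤ Bℝ`,
`matAbar Ā ≤ Aℝ`, `matBR B̄ ≤ B̄ℝ`, `vecP PE ≤ wℝ` (compared via `ENNReal.ofReal`): `x ↦ (Ξ x).toReal` is summable
and `Σ_x (Ξ x).toReal ≤ uℝ ⬝ᵥ ((Bℝ^M * Aℝ * B̄ℝ^m) *ᵥ wℝ)`.  At `m = 0` the right side is `uℝ Bℝ^{N−1} Aℝ wℝ`, the
evaluated form of the first display of (5.34)/(5.37).
[cite: FitznerVanDerHofstad2017, Prop. 5.5 (5.34), Prop. 5.6 (5.37), §5.4, Lemma 6.1 (6.51) (arXiv:1506.07977v2 pp. 53, 56, 66)] -/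
theorem tsum_toReal_le_of_xSpaceBound_of_majorants [AddCommGroup G] [Fintype ι] [DecidableEq ι] [Fintype K]
    {B A Bb : K → ι → ι → G → G → G → G → ℝ≥0∞} (hB : ∀ κ a b, IsTransInv (B κ a b))
    (hA : ∀ κ a b, IsTransInv (A κ a b)) (hBb : ∀ κ a b, IsTransInv (Bb κ a b)) (Ξ : G → ℝ≥0∞)
    (PS PE : ι → G → G → ℝ≥0∞) (M m : ℕ)
    (hΞ : ∀ x, Ξ x ≤ ∑' u, ∑' w, ∑' t, ∑' z, ∑ κ, ∑ a, ∑ b,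
      recP PS B M a u w * A κ a b u w t z * recR PE Bb m b (z - x) (t - x))
    {uR wR : ι → ℝ} {BR AR BbR : Matrix ι ι ℝ}
    (hu0 : ∀ a, 0 ≤ uR a) (hw0 : ∀ b, 0 ≤ wR b) (hB0 : ∀ a b, 0 ≤ BR a b) (hA0 : ∀ a b, 0 ≤ AR a b)
    (hBb0 : ∀ a b, 0 ≤ BbR a b)
    (hPS : ∀ a, vecP PS a ≤ ENNReal.ofReal (uR a)) (hPE : ∀ b, vecP PE b ≤ ENNReal.ofReal (wR b))
    (hmB : ∀ a b, matB B a b ≤ ENNReal.ofReal (BR a b)) (hmA : ∀ a b, matAbar A a b ≤ ENNReal.ofReal (AR a b))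
    (hmBb : ∀ a b, matBR Bb a b ≤ ENNReal.ofReal (BbR a b)) :
    Summable (fun x => (Ξ x).toReal) ∧ ∑' x, (Ξ x).toReal ≤ uR ⬝ᵥ ((BR ^ M * AR * BbR ^ m) *ᵥ wR) :=
  summable_toReal_and_tsum_le_of_majorants hu0 hw0 hB0 hA0 hBb0 hPS hPE hmB hmA hmBb M m
    (tsum_le_dotProduct_mulVec hB hA hBb Ξ PS PE M m hΞ)

end RealBoundMajorants

end Literature.Probability.FitznerVanDerHofstad2017.BlockSummation

end
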